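import Literature.NumberTheory.EllipticCurves.HeegnerPointsClassGroupInjProofs
import Literature.NumberTheory.EllipticCurves.HeegnerPointsImaginaryQuadraticProofs
import Literature.NumberTheory.QuadraticFields.BinaryQuadraticFormsRepresentation
import HarnessLib

/-!
# Heegner forms and ideal classes, III: every class contains a Heegner form; `#reps = h(K)`

Companion (theorems only) to `Literature.NumberTheory.EllipticCurves.HeegnerPoints`, last of three
files proving the named fact
`Literature.NumberTheory.EllipticCurves.HeegnerDatum.card_reps_eq_classNumber`:

> For `K` imaginary quadratic, `N ≥ 1` and a Heegner datum `H` of level `N` and discriminant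
> `d_K` (residue `β`, `β² ≡ d_K (mod 4N)`, and a complete irredundant system `H.reps` of
> representatives of the `Γ₀(N)`-classes of Heegner forms `(A, B, C)`, `B² − 4AC = d_K`, `A > 0`,
> `N ∣ A`, `B ≡ β (mod 2N)`), `#H.reps = h(K)`.

This is Gross, *Heegner points on `X₀(N)`* (1984), §I.1 (the Heegner points `(𝓞_K, 𝔫, [𝔞])`,
`[𝔞] ∈ Cl(K)`, of level `N` and discriminant `d_K` with fixed `𝔫`) and Gross–Kohnen–Zagier 1987,
§I.1, pp. 504–505 (`Q_{N,β,D}/Γ₀(N) ≅ Cl(K)` for fundamental `D`), proved here through the map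
`Q = (A, B, C) ↦ [𝔞_Q]`, `𝔞_Q = (A, ω − (B + t)/2) = ℤA ⊕ ℤ(−B + √d_K)/2` for an integral basis
`(1, ω)` of `𝓞 K`, `ω² = m + tω`, `d_K = t² + 4m`:

* well defined on `Γ₀(N)`-classes: `exists_span_mul_formIdeal_eq_of_isGamma0Equiv`
  (`HeegnerPointsClassGroupProofs`);
* injective: `isGamma0Equiv_of_span_mul_formIdeal_eq` (`HeegnerPointsClassGroupInjProofs`);
* **surjective** (`exists_heegnerForm_mk0_formIdeal_eq`, this file): given a class `c`, write a
  representative of `c · [𝔫]⁻¹` (`𝔫 = (N, ω − (β + t)/2)`) as `g · 𝔞_{Q₀}`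
  (`exists_eq_span_singleton_mul_span_pair`, Cox Thm. 7.7), move `Q₀` within its `SL₂(ℤ)`-class
  to `Q₁ = (a₁, b₁, c₁)` with `gcd(a₁, N) = 1` (Cox, Lemma 2.25 with Lemma 2.3,
  `BinQF.exists_properEquiv_isPosPrim_isCoprime_a`; the class of `𝔞` is unchanged,
  `sl2_formIdeal_eq`), solve `B ≡ b₁ (mod 2a₁)`, `B ≡ β (mod 2N)` and put `Q = (a₁N, B, C)`:
  then `𝔞_Q = 𝔞_{Q₁} · 𝔫` (`span_pair_mul_span_pair_of_isCoprime`), so `[𝔞_Q] = c`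
  (Gross 1984, §I.1: `𝔞 ↦ (𝓞, 𝔫, [𝔞])`; GKZ 1987, p. 505, surjectivity of
  `Q_{N,β,D}/Γ₀(N) → Q_D/Γ(1)`);
* the count `HeegnerDatum.card_reps_eq_classNumber_holds`: `Q ↦ [𝔞_Q]` is a bijection
  `H.reps → Cl(𝓞 K)` (Mathlib `ClassGroup`, `NumberField.classNumber`).

The Heegner hypothesis in the statement is not needed for the count (only the existence of `β`,
which is part of the datum); all forms of discriminant `d_K` are primitive
(`isUnit_of_dvd_of_disc_eq`).

## References

* B. H. Gross, *Heegner points on `X₀(N)`*, in *Modular Forms* (Durham 1983), Horwood (1984),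
  87–105, §I.1.
* B. Gross, W. Kohnen, D. Zagier, *Heegner points and derivatives of `L`-series. II*, Math. Ann.
  278 (1987), 497–562, §I.1.
* D. A. Cox, *Primes of the form x² + ny²*, 2nd ed., Wiley (2013), §2.C Lemma 2.25, §7.B
  Thm. 7.7, §7.C (7.12).
-/

noncomputable section

open scoped MatrixGroups nonZeroDivisors

open Module NumberField CongruenceSubgroup UpperHalfPlane
open Literature.NumberTheory.QuadraticFields.Quadratic

universe u

namespace Literature.NumberTheory.EllipticCurves

section Surjective

variable {K : Type*} [Field K] [NumberField K]

omit [NumberField K] in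
/-- The ideal `(A, ω − k)` of `𝓞 K` is a non-zero-divisor (i.e. non-zero) for `A ≠ 0`.
[folklore] -/
theorem span_pair_mem_nonZeroDivisors (b : Basis (Fin 2) ℤ (𝓞 K)) (hb : b 0 = 1) {A : ℤ}
    (hA : A ≠ 0) (k : ℤ) : Ideal.span {(A : 𝓞 K), b 1 - k} ∈ (Ideal (𝓞 K))⁰ := by
  rw [mem_nonZeroDivisors_iff_ne_zero, ne_eq, Submodule.zero_eq_bot, Ideal.span_eq_bot]
  push Not
  refine ⟨(A : 𝓞 K), by simp, fun h ↦ hA (intCast_eq_zero_of_basis b hb h)⟩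

/-- **Surjectivity of `[Q] ↦ [𝔞_Q]`: every ideal class contains the ideal of a Heegner form with
prescribed `β`.** Let `(1, ω)` be an integral basis of `K`, `ω² = m + tω`, `D = t² + 4m < 0`,
`N ≥ 1` and `β² ≡ D (mod 4N)`. For every class `c ∈ Cl(𝓞 K)` there is a Heegner form
`Q = (A, B, C)` of level `N`, discriminant `D`, `B ≡ β (mod 2N)`, with `[𝔞_Q] = c`,
`𝔞_Q = (A, ω − (B + t)/2)`. (Gross 1984, §I.1: the Heegner points `(𝓞, 𝔫, [𝔞])` run over all
`[𝔞] ∈ Cl(K)`; Gross–Kohnen–Zagier 1987, §I.1, p. 505. Proof: a representative `g · 𝔞_{Q₀}` of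
`c[𝔫]⁻¹` (Cox, Thm. 7.7), `Q₁ ∼ Q₀` with `gcd(a₁, N) = 1` (Cox, Lemma 2.25), the Chinese remainder
theorem for `B`, and `𝔞_Q = 𝔞_{Q₁} 𝔫`.) [cite: Gross1984, §I.1] -/
theorem exists_heegnerForm_mk0_formIdeal_eq (b : Basis (Fin 2) ℤ (𝓞 K)) (hb : b 0 = 1)
    {t m : ℤ} (hω : b 1 * b 1 = (m : 𝓞 K) + (t : 𝓞 K) * b 1) (hneg : t ^ 2 + 4 * m < 0)
    {N : ℕ} [NeZero N] {β : ℤ} (hβ : (4 * N : ℤ) ∣ β ^ 2 - (t ^ 2 + 4 * m))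
    (c : ClassGroup (𝓞 K)) :
    ∃ Q : ℤ × ℤ × ℤ, Q ∈ heegnerForms N (t ^ 2 + 4 * m) ∧ Q.2.1 ≡ β [ZMOD 2 * N] ∧
      ∃ h0 : Ideal.span {(Q.1 : 𝓞 K), b 1 - (((Q.2.1 + t) / 2 : ℤ) : 𝓞 K)} ∈ (Ideal (𝓞 K))⁰,
        ClassGroup.mk0 ⟨_, h0⟩ = c := by
  classical
  have hN0 : (N : ℤ) ≠ 0 := by exact_mod_cast NeZero.ne N
  have hNpos : (0 : ℤ) < N := by exact_mod_cast Nat.pos_of_ne_zero (NeZero.ne N)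
  -- the ideal `𝔫 = (N, ω - k_β)`
  obtain ⟨C₀, hC₀⟩ := hβ
  have hdiscβ : β ^ 2 - 4 * N * C₀ = t ^ 2 + 4 * m := by linarith
  set kβ : ℤ := (β + t) / 2 with hkβ
  have h2kβ : 2 * kβ = β + t := two_mul_ediv_two_of_disc_eq hdiscβ
  have hnβ : (N : ℤ) * C₀ = kβ ^ 2 - t * kβ - m := norm_eq_of_disc_eq hdiscβ h2kβ
  set 𝔫 : Ideal (𝓞 K) := Ideal.span {((N : ℤ) : 𝓞 K), b 1 - kβ} with h𝔫def
  have h𝔫 : 𝔫 ∈ (Ideal (𝓞 K))⁰ := span_pair_mem_nonZeroDivisors b hb hN0 kβ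
  -- an integral representative `J = g · (a, ω - k₀)` of `c · [𝔫]⁻¹`
  obtain ⟨J, hJ⟩ := ClassGroup.mk0_surjective (c * (ClassGroup.mk0 ⟨𝔫, h𝔫⟩)⁻¹)
  have hJ0 : (J : Ideal (𝓞 K)) ≠ ⊥ := by
    have hJ2 := J.2
    rw [mem_nonZeroDivisors_iff_ne_zero] at hJ2
    simpa using hJ2
  obtain ⟨g, a, k₀, c₀, hg, ha, hn₀, hJeq⟩ := exists_eq_span_singleton_mul_span_pair b hb hω hJ0
  -- the form `Q₀ = (a, 2k₀ - t, c₀)` is primitive positive definite of discriminant `D`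
  have hdisc₀ : (2 * k₀ - t) ^ 2 - 4 * a * c₀ = t ^ 2 + 4 * m := by
    linear_combination (-4) * hn₀
  have hD₀ : (2 * k₀ - t) ^ 2 - 4 * a * c₀ < 0 := hdisc₀ ▸ hneg
  have hpp : (⟨a, 2 * k₀ - t, c₀⟩ : BinQF).IsPosPrim (t ^ 2 + 4 * m) :=
    ⟨hdisc₀, ha, (BinQF.isPrimitive_iff _).mpr
      fun d h1 h2 h3 ↦ isUnit_of_dvd_of_disc_eq b hb hω hdisc₀ h1 h2 h3⟩
  -- Cox, Lemma 2.25: an `SL₂(ℤ)`-equivalent form with leading coefficient prime to `N`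
  obtain ⟨f', ⟨p₁, q₁, r₁, s₁, hdet₁, hf'⟩, -, hcop⟩ :=
    BinQF.exists_properEquiv_isPosPrim_isCoprime_a hneg hpp hN0
  rw [hf'] at hcop
  change IsCoprime (a * p₁ ^ 2 + (2 * k₀ - t) * p₁ * r₁ + c₀ * r₁ ^ 2) (N : ℤ) at hcop
  -- the same in the parametrisation of `sl2_smul_heegnerTau` / `sl2_formIdeal_eq`
  obtain ⟨p, q, r, s, hdet, hcop'⟩ : ∃ p q r s : ℤ, p * s - q * r = 1 ∧
      IsCoprime (a * s ^ 2 - (2 * k₀ - t) * s * r + c₀ * r ^ 2) (N : ℤ) :=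
    ⟨s₁, -q₁, -r₁, p₁, by linear_combination hdet₁, by
      have e : a * p₁ ^ 2 - (2 * k₀ - t) * p₁ * -r₁ + c₀ * (-r₁) ^ 2 =
          a * p₁ ^ 2 + (2 * k₀ - t) * p₁ * r₁ + c₀ * r₁ ^ 2 := by ring
      rw [e]
      exact hcop⟩
  set a₁ : ℤ := a * s ^ 2 - (2 * k₀ - t) * s * r + c₀ * r ^ 2 with ha₁
  set k₁ : ℤ := -(a * q * s) + k₀ * (p * s + q * r) - t * q * r - c₀ * p * r with hk₁
  set c₁ : ℤ := a * q ^ 2 - (2 * k₀ - t) * p * q + c₀ * p ^ 2 with hc₁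
  have ha₁pos : 0 < a₁ := by
    have hsr : s ≠ 0 ∨ -r ≠ 0 := by
      by_contra h0
      push Not at h0
      rw [h0.1, neg_eq_zero.mp h0.2] at hdet
      simp at hdet
    have h := posDef_of_disc_neg ha hD₀ (x := s) (y := -r) hsr
    rw [ha₁]
    linarith [show a * s ^ 2 + (2 * k₀ - t) * s * -r + c₀ * (-r) ^ 2 =
      a * s ^ 2 - (2 * k₀ - t) * s * r + c₀ * r ^ 2 by ring]
  have hdisc₁ : (2 * k₁ - t) ^ 2 - 4 * a₁ * c₁ = t ^ 2 + 4 * m := by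
    rw [← hdisc₀, hk₁, ha₁, hc₁]
    linear_combination (((2 * k₀ - t) ^ 2 - 4 * a * c₀) * (p * s - q * r + 1)
      + 2 * (-(2 * a * q * s) + (2 * k₀ - t) * (p * s + q * r) - 2 * c₀ * p * r) * t
      + t ^ 2 * (p * s - q * r - 1)) * hdet
  have hn₁ : a₁ * c₁ = k₁ ^ 2 - t * k₁ - m :=
    norm_eq_of_disc_eq hdisc₁ (by ring : 2 * k₁ = (2 * k₁ - t) + t)
  -- the class of `(a₁, ω - k₁)` is that of `(a, ω - k₀)`, i.e. of `J`
  have hI₁ := sl2_formIdeal_eq b hω hn₀ hdet ha₁ hk₁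
  -- Chinese remainder: `k ≡ k₁ (mod a₁)`, `k ≡ k_β (mod N)`
  obtain ⟨u, v, huv⟩ := hcop'
  set k : ℤ := kβ * u * a₁ + k₁ * v * N with hk
  have hk1 : a₁ ∣ k - k₁ := ⟨u * (kβ - k₁), by linear_combination k₁ * huv⟩
  have hk2 : (N : ℤ) ∣ k - kβ := ⟨v * (k₁ - kβ), by linear_combination kβ * huv⟩
  have hdvd : a₁ * N ∣ k ^ 2 - t * k - m := by
    apply IsCoprime.mul_dvd ⟨u, v, huv⟩
    · have : k ^ 2 - t * k - m = (k - k₁) * (k + k₁ - t) + a₁ * c₁ := by rw [hn₁]; ring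
      rw [this]
      exact dvd_add (dvd_mul_of_dvd_left hk1 _) (dvd_mul_right _ _)
    · have : k ^ 2 - t * k - m = (k - kβ) * (k + kβ - t) + N * C₀ := by rw [hnβ]; ring
      rw [this]
      exact dvd_add (dvd_mul_of_dvd_left hk2 _) (dvd_mul_right _ _)
  obtain ⟨C, hC⟩ := hdvd
  -- the Heegner form `Q = (a₁ N, 2k - t, C)`
  have hdiscQ : (2 * k - t) ^ 2 - 4 * (a₁ * N) * C = t ^ 2 + 4 * m := by
    linear_combination 4 * hC
  refine ⟨(a₁ * N, 2 * k - t, C), ⟨hdiscQ, mul_pos ha₁pos hNpos, Dvd.intro_left a₁ rfl,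
    fun d h1 h2 h3 ↦ isUnit_of_dvd_of_disc_eq b hb hω hdiscQ h1 h2 h3⟩, ?_, ?_⟩
  · -- `2k - t ≡ β (mod 2N)`
    change 2 * k - t ≡ β [ZMOD 2 * N]
    rw [Int.modEq_iff_dvd]
    obtain ⟨w, hw⟩ := hk2
    exact ⟨-w, by linear_combination (-1 : ℤ) * h2kβ - 2 * hw⟩
  · dsimp only
    have hkQ : (2 * k - t + t) / 2 = k := by omega
    rw [hkQ]
    have h0 : Ideal.span {((a₁ * N : ℤ) : 𝓞 K), b 1 - k} ∈ (Ideal (𝓞 K))⁰ :=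
      span_pair_mem_nonZeroDivisors b hb (mul_pos ha₁pos hNpos).ne' k
    refine ⟨h0, ?_⟩
    -- `𝔞_Q = (a₁, ω - k₁) · 𝔫`
    have hprod : Ideal.span {(a₁ : 𝓞 K), b 1 - k} * Ideal.span {((N : ℤ) : 𝓞 K), b 1 - k} =
        Ideal.span {((a₁ * N : ℤ) : 𝓞 K), b 1 - k} :=
      span_pair_mul_span_pair_of_isCoprime b hω ⟨u, v, huv⟩ hC.symm
    have hI₁eq : Ideal.span {(a₁ : 𝓞 K), b 1 - k} = Ideal.span {(a₁ : 𝓞 K), b 1 - k₁} :=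
      span_pair_eq_span_pair_of_dvd_sub (b 1) hk1
    have h𝔫eq : Ideal.span {((N : ℤ) : 𝓞 K), b 1 - k} = 𝔫 :=
      span_pair_eq_span_pair_of_dvd_sub (b 1) hk2
    have h1 : Ideal.span {(a₁ : 𝓞 K), b 1 - k₁} ∈ (Ideal (𝓞 K))⁰ :=
      span_pair_mem_nonZeroDivisors b hb ha₁pos.ne' k₁
    have hsub : (⟨_, h0⟩ : (Ideal (𝓞 K))⁰) = ⟨_, h1⟩ * ⟨𝔫, h𝔫⟩ := by
      apply Subtype.ext
      change Ideal.span _ = Ideal.span _ * 𝔫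
      rw [← hprod, hI₁eq, h𝔫eq]
    rw [hsub, map_mul]
    have hJa : Ideal.span {(a : 𝓞 K), b 1 - k₀} ∈ (Ideal (𝓞 K))⁰ :=
      span_pair_mem_nonZeroDivisors b hb ha.ne' k₀
    have e1 : ClassGroup.mk0 ⟨_, h1⟩ = ClassGroup.mk0 ⟨_, hJa⟩ := by
      rw [ClassGroup.mk0_eq_mk0_iff]
      exact ⟨(r : 𝓞 K) * (b 1 - k₀) + s * a, a₁, row_comb_ne_zero b hb ha.ne' hdet,
        by exact_mod_cast ha₁pos.ne', hI₁.symm⟩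
    have e2 : ClassGroup.mk0 ⟨_, hJa⟩ = ClassGroup.mk0 J := by
      rw [ClassGroup.mk0_eq_mk0_iff]
      refine ⟨g, 1, by exact_mod_cast hg.ne', one_ne_zero, ?_⟩
      rw [Ideal.span_singleton_one, Ideal.top_mul]
      exact hJeq.symm
    rw [e1, e2, hJ, inv_mul_cancel_right]

end Surjective

/-! ### The count -/

/-- **Discharge of `Literature.NumberTheory.EllipticCurves.HeegnerDatum.card_reps_eq_classNumber`**
(Gross, *Heegner points on `X₀(N)`* (1984), §I.1; Gross–Kohnen–Zagier 1987, §I.1, pp. 504–505):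
for `K` imaginary quadratic, `N ≥ 1` and a Heegner datum `H` of level `N` and discriminant `d_K`,
the number of representatives (= of `Γ₀(N)`-classes of Heegner forms `(A, B, C)` of level `N`,
discriminant `d_K`, `B ≡ β (mod 2N)`) is the class number `h(K)`. Proof: with an integral basis
`(1, ω)` of `𝓞 K` (`exists_basis_zero_eq_one`, `d_K = t² + 4m`), the map
`Q ↦ [𝔞_Q] ∈ Cl(𝓞 K)`, `𝔞_Q = (A, ω − (B + t)/2)`, is injective on `H.reps`
(`isGamma0Equiv_of_span_mul_formIdeal_eq` and irredundancy) and surjective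
(`exists_heegnerForm_mk0_formIdeal_eq`, completeness of `H.reps` and
`exists_span_mul_formIdeal_eq_of_isGamma0Equiv`). The Heegner hypothesis is not used.
[cite: Gross1984, §I.1] -/
theorem HeegnerDatum.card_reps_eq_classNumber_holds (N : ℕ) [NeZero N] (K : Type u) [Field K]
    [NumberField K] : HeegnerDatum.card_reps_eq_classNumber N K := by
  intro hK _ H
  classical
  obtain ⟨b, hb⟩ := exists_basis_zero_eq_one hK.1
  set t : ℤ := b.repr (b 1 * b 1) 1 with ht
  set m : ℤ := b.repr (b 1 * b 1) 0 with hm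
  have hω : b 1 * b 1 = (m : 𝓞 K) + (t : 𝓞 K) * b 1 := basis_one_mul_self_eq b hb
  have hD : NumberField.discr K = t ^ 2 + 4 * m := discr_eq_sq_add_four_mul b hb
  have hneg : t ^ 2 + 4 * m < 0 := hD ▸ hK.discr_neg
  have hmem : ∀ Q ∈ H.reps, Q ∈ heegnerForms N (t ^ 2 + 4 * m) ∧ Q.2.1 ≡ H.β [ZMOD 2 * N] := by
    intro Q hQ
    obtain ⟨h1, h2⟩ := H.mem_heegnerForms Q hQ
    rw [hD] at h1
    exact ⟨h1, h2⟩
  have hβ : (4 * N : ℤ) ∣ H.β ^ 2 - (t ^ 2 + 4 * m) := by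
    rw [← hD]
    exact H.dvd_sq_sub
  -- the map `Q ↦ [𝔞_Q]`
  have h0 : ∀ Q ∈ H.reps,
      Ideal.span {(Q.1 : 𝓞 K), b 1 - (((Q.2.1 + t) / 2 : ℤ) : 𝓞 K)} ∈ (Ideal (𝓞 K))⁰ :=
    fun Q hQ ↦ by
      obtain ⟨⟨-, hA, -, -⟩, -⟩ := hmem Q hQ
      exact span_pair_mem_nonZeroDivisors b hb hA.ne' _
  let f : H.reps → ClassGroup (𝓞 K) := fun Q ↦ ClassGroup.mk0 ⟨_, h0 Q.1 Q.2⟩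
  have hf_inj : Function.Injective f := by
    rintro ⟨Q₁, h₁⟩ ⟨Q₂, h₂⟩ heq
    change ClassGroup.mk0 _ = ClassGroup.mk0 _ at heq
    obtain ⟨x, y, hx, -, hxy⟩ := ClassGroup.mk0_eq_mk0_iff.mp heq
    have hequiv : IsGamma0Equiv N Q₁ Q₂ :=
      isGamma0Equiv_of_span_mul_formIdeal_eq b hb hω hneg (hmem Q₁ h₁).1 (hmem Q₂ h₂).1
        ((hmem Q₁ h₁).2.trans (hmem Q₂ h₂).2.symm) hx hxy
    by_contra hne
    exact H.pairwise_not_isGamma0Equiv h₁ h₂ (fun h ↦ hne (Subtype.ext h)) hequiv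
  have hf_surj : Function.Surjective f := by
    intro c
    obtain ⟨Q₀, hQ₀, hβ₀, h00, hc⟩ := exists_heegnerForm_mk0_formIdeal_eq b hb hω hneg hβ c
    obtain ⟨Q', hQ', heqv⟩ := H.exists_isGamma0Equiv Q₀ (by rw [hD]; exact hQ₀) hβ₀
    refine ⟨⟨Q', hQ'⟩, ?_⟩
    obtain ⟨hd₀, hA₀, -, -⟩ := hQ₀
    obtain ⟨⟨hd', hA', -, -⟩, -⟩ := hmem Q' hQ'
    obtain ⟨x, y, hx, hy, hxy⟩ :=
      exists_span_mul_formIdeal_eq_of_isGamma0Equiv b hb hω hneg hA₀ hd₀ hA' hd' heqv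
    rw [← hc]
    change ClassGroup.mk0 _ = ClassGroup.mk0 _
    exact ClassGroup.mk0_eq_mk0_iff.mpr ⟨y, x, hy, hx, hxy.symm⟩
  have hcard := Fintype.card_of_bijective ⟨hf_inj, hf_surj⟩
  rw [Fintype.card_coe] at hcard
  rw [hcard]
  rfl

end Literature.NumberTheory.EllipticCurves

end
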